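import Summits.AtomisticToContinuum.Crystallization.Theorems.SquareWellLayerCakeStackingFaultSparsityLocalFramesStructureA

/-!
# Local frames, structure side B: the exact local-to-global structure theorem

Crux `StackingFaultSparsity` (stmt-AtomisticToContinuum-14296), line `Sketch`, reshape 11, the lead's glue — part 2B.

`barlow_of_localFrames` (registered helper of `stub_leadGlue`): the statements of the three geometric stubs
`stub_barlowOfOneLength` (S12), `stub_barlowOfCommonNormal` (S3), `stub_frameDichotomy` (S4) imply that a point set
`X ∋ 0` all of whose points carry an exact local frame is an isometric image of a Barlow stacking
`barlowStacking a h s` with `a, h ∈ (1/2, 2)`.  Proof: fix one frame per point (`choose`); the bond component `K` of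
`0` (`Relation.ReflTransGen` of `dist ≤ 1` inside `X`) is bond-closed, so every frame restricts to `K`
(`locframe_restrict`); along bonds the lengths `(a, b)` are constant and, in the two-length case, so is the normal up
to sign (S4, induction on the path); hence S12 (one length) or S3 (common frame) applies to `K`; finally `X = K` by the
covering radius (`eq_of_barlow_subset`).  All `[folklore]` bookkeeping over the stubs' statements.
-/

noncomputable section

namespace Summit.AtomisticToContinuum.Crystallization.Theorems.SquareWellLayerCake.StackingFaultSparsity.LocalFrames.Structure

open Literature.MathematicalPhysics.StatisticalMechanics
open Summit.AtomisticToContinuum.Crystallization.Theorems.PeriodicWindowsSketch (sqrt_gap_bounds)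

/-- The level gap `√(b² − a²/3)` is at most `9/10` for `a, b ∈ [19/20, 1]`. [folklore] -/
theorem sqrt_gap_le :
    ∀ {a b : ℝ}, 19 / 20 ≤ a → b ≤ 1 → 19 / 20 ≤ b → Real.sqrt (b ^ 2 - a ^ 2 / 3) ≤ 9 / 10 := by
  intro a b ha1 hb2 hb1
  rw [show (9 / 10 : ℝ) = Real.sqrt ((9 / 10) ^ 2) by rw [Real.sqrt_sq (by norm_num)]]
  exact Real.sqrt_le_sqrt (by nlinarith)

/-- **The exact local-to-global structure theorem** (registered helper of `stub_leadGlue`; see the module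
docstring). [folklore] -/
theorem barlow_of_localFrames :
    (∀ (X : Set (EuclideanSpace ℝ (Fin 3))) (d : ℝ), X.Nonempty → (∀ p ∈ X, ∃ (n : EuclideanSpace ℝ (Fin 3)) (c : ℤ → ℝ), (19 / 20 ≤ d ∧ d ≤ 1 ∧ 19 / 20 ≤ d ∧ d ≤ 1 ∧ ‖n‖ = 1 ∧ c 0 = 0 ∧ (∀ k : ℤ, c k + 19 / 25 ≤ c (k + 1)) ∧ (∀ q ∈ X, ∀ r ∈ X, q ≠ r → 19 / 20 ≤ dist q r) ∧ (∀ q ∈ X, dist q p < 2 → ∃ k : ℤ, inner ℝ (q - p) n = c k) ∧ (∃ H U D : Finset (EuclideanSpace ℝ (Fin 3)), H.card = 6 ∧ U.card = 3 ∧ D.card = 3 ∧ (∀ q ∈ H, q ∈ X ∧ inner ℝ (q - p) n = 0 ∧ dist p q = d) ∧ (∀ q ∈ U, q ∈ X ∧ inner ℝ (q - p) n = c 1 ∧ dist p q = d) ∧ (∀ q ∈ D, q ∈ X ∧ inner ℝ (q - p) n = c (-1) ∧ dist p q = d) ∧ (∀ q ∈ X, q ≠ p → dist q p ≤ 1 →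 q ∈ H ∨ q ∈ U ∨ q ∈ D)) ∧ (∀ q ∈ X, q ≠ p → dist q p ≤ 1 → (∃ H' : Finset (EuclideanSpace ℝ (Fin 3)), H'.card = 6 ∧ ∀ r ∈ H', r ∈ X ∧ r ≠ q ∧ inner ℝ (r - p) n = inner ℝ (q - p) n ∧ dist q r = d) ∧ (∃ U' : Finset (EuclideanSpace ℝ (Fin 3)), U'.card = 3 ∧ ∀ r ∈ U', r ∈ X ∧ (∃ k : ℤ, inner ℝ (q - p) n = c k ∧ inner ℝ (r - p) n = c (k + 1)) ∧ dist q r = d) ∧ (∃ D' : Finset (EuclideanSpace ℝ (Fin 3)), D'.card = 3 ∧ ∀ r ∈ D', r ∈ X ∧ (∃ k : ℤ, inner ℝ (q - p) n = c k ∧ inner ℝ (r - p) n = c (k - 1)) ∧ dist q r = d) ∧ (∀ r ∈ X, r ≠ q → dist q r < 1 → (inner ℝ (r - p) n = inner ℝ (q - p) n → dist q r = d) ∧ (inner ℝ (r - p) n ≠ inner ℝ (q - p) n → dist q r = d))))) → ∃ s : ℤ → ℤ, Literature.MathematicalPhysics.StatisticalMechanics.IsHaggSeq s ∧ ∃ g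 : EuclideanSpace ℝ (Fin 3) ≃ᵢ EuclideanSpace ℝ (Fin 3), X = g '' Literature.MathematicalPhysics.StatisticalMechanics.barlowStacking d (√(d ^ 2 - d ^ 2 / 3)) s) → (∀ (X : Set (EuclideanSpace ℝ (Fin 3))) (a b : ℝ) (n : EuclideanSpace ℝ (Fin 3)), X.Nonempty → (∀ p ∈ X, (∃ c : ℤ → ℝ, (19 / 20 ≤ a ∧ a ≤ 1 ∧ 19 / 20 ≤ b ∧ b ≤ 1 ∧ ‖n‖ = 1 ∧ c 0 = 0 ∧ (∀ k : ℤ, c k + 19 / 25 ≤ c (k + 1)) ∧ (∀ q ∈ X, ∀ r ∈ X, q ≠ r → 19 / 20 ≤ dist q r) ∧ (∀ q ∈ X, dist q p < 2 → ∃ k : ℤ, inner ℝ (q - p) n = c k) ∧ (∃ H U D : Finset (EuclideanSpace ℝ (Fin 3)), H.card = 6 ∧ U.card = 3 ∧ D.card = 3 ∧ (∀ q ∈ H, q ∈ X ∧ inner ℝ (q - p) n = 0 ∧ dist p q = a) ∧ (∀ q ∈ U, q ∈ X ∧ inner ℝ (q - p) n = c 1 ∧ dist p q = b) ∧ (∀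 q ∈ D, q ∈ X ∧ inner ℝ (q - p) n = c (-1) ∧ dist p q = b) ∧ (∀ q ∈ X, q ≠ p → dist q p ≤ 1 → q ∈ H ∨ q ∈ U ∨ q ∈ D)) ∧ (∀ q ∈ X, q ≠ p → dist q p ≤ 1 → (∃ H' : Finset (EuclideanSpace ℝ (Fin 3)), H'.card = 6 ∧ ∀ r ∈ H', r ∈ X ∧ r ≠ q ∧ inner ℝ (r - p) n = inner ℝ (q - p) n ∧ dist q r = a) ∧ (∃ U' : Finset (EuclideanSpace ℝ (Fin 3)), U'.card = 3 ∧ ∀ r ∈ U', r ∈ X ∧ (∃ k : ℤ, inner ℝ (q - p) n = c k ∧ inner ℝ (r - p) n = c (k + 1)) ∧ dist q r = b) ∧ (∃ D' : Finset (EuclideanSpace ℝ (Fin 3)), D'.card = 3 ∧ ∀ r ∈ D', r ∈ X ∧ (∃ k : ℤ, inner ℝ (q - p) n = c k ∧ inner ℝ (r - p) n = c (k - 1)) ∧ dist q r = b) ∧ (∀ r ∈ X, r ≠ q → dist q r < 1 → (inner ℝ (r - p) n = inner ℝ (q - p) n → dist q r = a) ∧ (inner ℝ (r - p) n ≠ inner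 ℝ (q - p) n → dist q r = b))))) ∨ (∃ c : ℤ → ℝ, (19 / 20 ≤ a ∧ a ≤ 1 ∧ 19 / 20 ≤ b ∧ b ≤ 1 ∧ ‖(-n)‖ = 1 ∧ c 0 = 0 ∧ (∀ k : ℤ, c k + 19 / 25 ≤ c (k + 1)) ∧ (∀ q ∈ X, ∀ r ∈ X, q ≠ r → 19 / 20 ≤ dist q r) ∧ (∀ q ∈ X, dist q p < 2 → ∃ k : ℤ, inner ℝ (q - p) (-n) = c k) ∧ (∃ H U D : Finset (EuclideanSpace ℝ (Fin 3)), H.card = 6 ∧ U.card = 3 ∧ D.card = 3 ∧ (∀ q ∈ H, q ∈ X ∧ inner ℝ (q - p) (-n) = 0 ∧ dist p q = a) ∧ (∀ q ∈ U, q ∈ X ∧ inner ℝ (q - p) (-n) = c 1 ∧ dist p q = b) ∧ (∀ q ∈ D, q ∈ X ∧ inner ℝ (q - p) (-n) = c (-1) ∧ dist p q = b) ∧ (∀ q ∈ X, q ≠ p → dist q p ≤ 1 → q ∈ H ∨ q ∈ U ∨ q ∈ D)) ∧ (∀ q ∈ X, q ≠ p → dist q p ≤ 1 → (∃ H' : Finset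 (EuclideanSpace ℝ (Fin 3)), H'.card = 6 ∧ ∀ r ∈ H', r ∈ X ∧ r ≠ q ∧ inner ℝ (r - p) (-n) = inner ℝ (q - p) (-n) ∧ dist q r = a) ∧ (∃ U' : Finset (EuclideanSpace ℝ (Fin 3)), U'.card = 3 ∧ ∀ r ∈ U', r ∈ X ∧ (∃ k : ℤ, inner ℝ (q - p) (-n) = c k ∧ inner ℝ (r - p) (-n) = c (k + 1)) ∧ dist q r = b) ∧ (∃ D' : Finset (EuclideanSpace ℝ (Fin 3)), D'.card = 3 ∧ ∀ r ∈ D', r ∈ X ∧ (∃ k : ℤ, inner ℝ (q - p) (-n) = c k ∧ inner ℝ (r - p) (-n) = c (k - 1)) ∧ dist q r = b) ∧ (∀ r ∈ X, r ≠ q → dist q r < 1 → (inner ℝ (r - p) (-n) = inner ℝ (q - p) (-n) → dist q r = a) ∧ (inner ℝ (r - p) (-n) ≠ inner ℝ (q - p) (-n) → dist q r = b)))))) → ∃ s : ℤ → ℤ, Literature.MathematicalPhysics.StatisticalMechanics.IsHaggSeq s ∧ ∃ g : EuclideanSpace ℝ (Fin 3) ≃ᵢ EuclideanSpace ℝ (Fin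 3), X = g '' Literature.MathematicalPhysics.StatisticalMechanics.barlowStacking a (√(b ^ 2 - a ^ 2 / 3)) s) → (∀ (X : Set (EuclideanSpace ℝ (Fin 3))) (p q : EuclideanSpace ℝ (Fin 3)) (a b a' b' : ℝ) (n n' : EuclideanSpace ℝ (Fin 3)) (c c' : ℤ → ℝ), p ∈ X → q ∈ X → p ≠ q → dist p q ≤ 1 → (19 / 20 ≤ a ∧ a ≤ 1 ∧ 19 / 20 ≤ b ∧ b ≤ 1 ∧ ‖n‖ = 1 ∧ c 0 = 0 ∧ (∀ k : ℤ, c k + 19 / 25 ≤ c (k + 1)) ∧ (∀ q ∈ X, ∀ r ∈ X, q ≠ r → 19 / 20 ≤ dist q r) ∧ (∀ q ∈ X, dist q p < 2 → ∃ k : ℤ, inner ℝ (q - p) n = c k) ∧ (∃ H U D : Finset (EuclideanSpace ℝ (Fin 3)), H.card = 6 ∧ U.card = 3 ∧ D.card = 3 ∧ (∀ q ∈ H, q ∈ X ∧ inner ℝ (q - p) n = 0 ∧ dist p q = a) ∧ (∀ q ∈ U, q ∈ X ∧ inner ℝ (q - p) n = c 1 ∧ dist p q = b) ∧ (∀ q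 ∈ D, q ∈ X ∧ inner ℝ (q - p) n = c (-1) ∧ dist p q = b) ∧ (∀ q ∈ X, q ≠ p → dist q p ≤ 1 → q ∈ H ∨ q ∈ U ∨ q ∈ D)) ∧ (∀ q ∈ X, q ≠ p → dist q p ≤ 1 → (∃ H' : Finset (EuclideanSpace ℝ (Fin 3)), H'.card = 6 ∧ ∀ r ∈ H', r ∈ X ∧ r ≠ q ∧ inner ℝ (r - p) n = inner ℝ (q - p) n ∧ dist q r = a) ∧ (∃ U' : Finset (EuclideanSpace ℝ (Fin 3)), U'.card = 3 ∧ ∀ r ∈ U', r ∈ X ∧ (∃ k : ℤ, inner ℝ (q - p) n = c k ∧ inner ℝ (r - p) n = c (k + 1)) ∧ dist q r = b) ∧ (∃ D' : Finset (EuclideanSpace ℝ (Fin 3)), D'.card = 3 ∧ ∀ r ∈ D', r ∈ X ∧ (∃ k : ℤ, inner ℝ (q - p) n = c k ∧ inner ℝ (r - p) n = c (k - 1)) ∧ dist q r = b) ∧ (∀ r ∈ X, r ≠ q → dist q r < 1 → (inner ℝ (r - p) n = inner ℝ (q - p) n → dist q r = a) ∧ (inner ℝ (r - p) n ≠ inner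 ℝ (q - p) n → dist q r = b)))) → (19 / 20 ≤ a' ∧ a' ≤ 1 ∧ 19 / 20 ≤ b' ∧ b' ≤ 1 ∧ ‖n'‖ = 1 ∧ c' 0 = 0 ∧ (∀ k : ℤ, c' k + 19 / 25 ≤ c' (k + 1)) ∧ (∀ r ∈ X, ∀ t ∈ X, r ≠ t → 19 / 20 ≤ dist r t) ∧ (∀ r ∈ X, dist r q < 2 → ∃ k : ℤ, inner ℝ (r - q) n' = c' k) ∧ (∃ H U D : Finset (EuclideanSpace ℝ (Fin 3)), H.card = 6 ∧ U.card = 3 ∧ D.card = 3 ∧ (∀ r ∈ H, r ∈ X ∧ inner ℝ (r - q) n' = 0 ∧ dist q r = a') ∧ (∀ r ∈ U, r ∈ X ∧ inner ℝ (r - q) n' = c' 1 ∧ dist q r = b') ∧ (∀ r ∈ D, r ∈ X ∧ inner ℝ (r - q) n' = c' (-1) ∧ dist q r = b') ∧ (∀ r ∈ X, r ≠ q → dist r q ≤ 1 → r ∈ H ∨ r ∈ U ∨ r ∈ D)) ∧ (∀ r ∈ X, r ≠ q → dist r q ≤ 1 → (∃ H' : Finset (EuclideanSpace ℝ (Fin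 3)), H'.card = 6 ∧ ∀ t ∈ H', t ∈ X ∧ t ≠ r ∧ inner ℝ (t - q) n' = inner ℝ (r - q) n' ∧ dist r t = a') ∧ (∃ U' : Finset (EuclideanSpace ℝ (Fin 3)), U'.card = 3 ∧ ∀ t ∈ U', t ∈ X ∧ (∃ k : ℤ, inner ℝ (r - q) n' = c' k ∧ inner ℝ (t - q) n' = c' (k + 1)) ∧ dist r t = b') ∧ (∃ D' : Finset (EuclideanSpace ℝ (Fin 3)), D'.card = 3 ∧ ∀ t ∈ D', t ∈ X ∧ (∃ k : ℤ, inner ℝ (r - q) n' = c' k ∧ inner ℝ (t - q) n' = c' (k - 1)) ∧ dist r t = b') ∧ (∀ t ∈ X, t ≠ r → dist r t < 1 → (inner ℝ (t - q) n' = inner ℝ (r - q) n' → dist r t = a') ∧ (inner ℝ (t - q) n' ≠ inner ℝ (r - q) n' → dist r t = b')))) → a' = a ∧ b' = b ∧ (a ≠ b → (n' = n ∨ n' = -n))) → ∀ (X : Set (EuclideanSpace ℝ (Fin 3))), (0 : EuclideanSpace ℝ (Fin 3)) ∈ X → (∀ p ∈ X, ∃ (a b : ℝ) (n : EuclideanSpace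 ℝ (Fin 3)) (c : ℤ → ℝ), (19 / 20 ≤ a ∧ a ≤ 1 ∧ 19 / 20 ≤ b ∧ b ≤ 1 ∧ ‖n‖ = 1 ∧ c 0 = 0 ∧ (∀ k : ℤ, c k + 19 / 25 ≤ c (k + 1)) ∧ (∀ q ∈ X, ∀ r ∈ X, q ≠ r → 19 / 20 ≤ dist q r) ∧ (∀ q ∈ X, dist q p < 2 → ∃ k : ℤ, inner ℝ (q - p) n = c k) ∧ (∃ H U D : Finset (EuclideanSpace ℝ (Fin 3)), H.card = 6 ∧ U.card = 3 ∧ D.card = 3 ∧ (∀ q ∈ H, q ∈ X ∧ inner ℝ (q - p) n = 0 ∧ dist p q = a) ∧ (∀ q ∈ U, q ∈ X ∧ inner ℝ (q - p) n = c 1 ∧ dist p q = b) ∧ (∀ q ∈ D, q ∈ X ∧ inner ℝ (q - p) n = c (-1) ∧ dist p q = b) ∧ (∀ q ∈ X, q ≠ p → dist q p ≤ 1 → q ∈ H ∨ q ∈ U ∨ q ∈ D)) ∧ (∀ q ∈ X, q ≠ p → dist q p ≤ 1 → (∃ H' : Finset (EuclideanSpace ℝ (Fin 3)), H'.card = 6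 ∧ ∀ r ∈ H', r ∈ X ∧ r ≠ q ∧ inner ℝ (r - p) n = inner ℝ (q - p) n ∧ dist q r = a) ∧ (∃ U' : Finset (EuclideanSpace ℝ (Fin 3)), U'.card = 3 ∧ ∀ r ∈ U', r ∈ X ∧ (∃ k : ℤ, inner ℝ (q - p) n = c k ∧ inner ℝ (r - p) n = c (k + 1)) ∧ dist q r = b) ∧ (∃ D' : Finset (EuclideanSpace ℝ (Fin 3)), D'.card = 3 ∧ ∀ r ∈ D', r ∈ X ∧ (∃ k : ℤ, inner ℝ (q - p) n = c k ∧ inner ℝ (r - p) n = c (k - 1)) ∧ dist q r = b) ∧ (∀ r ∈ X, r ≠ q → dist q r < 1 → (inner ℝ (r - p) n = inner ℝ (q - p) n → dist q r = a) ∧ (inner ℝ (r - p) n ≠ inner ℝ (q - p) n → dist q r = b))))) → ∃ a h : ℝ, 1 / 2 < a ∧ a < 2 ∧ 1 / 2 < h ∧ h < 2 ∧ ∃ s : ℤ → ℤ, Literature.MathematicalPhysics.StatisticalMechanics.IsHaggSeq s ∧ ∃ g : EuclideanSpace ℝ (Fin 3) ≃ᵢ EuclideanSpace ℝ (Fin 3),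 X = g '' Literature.MathematicalPhysics.StatisticalMechanics.barlowStacking a h s := by
  intro hS12 hS3 hS4 X h0 hall
  choose! fa fb fn fc hf using hall
  -- the bond component of `0`
  set K : Set (EuclideanSpace ℝ (Fin 3)) := {p | p ∈ X ∧ Relation.ReflTransGen (fun u v : EuclideanSpace ℝ (Fin 3) => u ∈ X ∧ v ∈ X ∧ dist u v ≤ 1) 0 p}
    with hKdef
  have hKX : K ⊆ X := fun p hp => hp.1
  have h0K : (0 : EuclideanSpace ℝ (Fin 3)) ∈ K := ⟨h0, Relation.ReflTransGen.refl⟩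
  have hcl : ∀ q ∈ K, ∀ r ∈ X, dist q r ≤ 1 → r ∈ K :=
    fun q hq r hr hqr => ⟨hr, hq.2.tail ⟨hq.1, hr, hqr⟩⟩
  -- propagation of the lengths (and, for two lengths, of the normal) along bonds
  have hprop : ∀ p : EuclideanSpace ℝ (Fin 3), Relation.ReflTransGen (fun u v : EuclideanSpace ℝ (Fin 3) => u ∈ X ∧ v ∈ X ∧ dist u v ≤ 1) 0 p →
      p ∈ X → fa p = fa 0 ∧ fb p = fb 0 ∧ (fa 0 ≠ fb 0 → fn p = fn 0 ∨ fn p = -fn 0) := by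
    intro p hpath
    induction hpath with
    | refl => intro _; exact ⟨rfl, rfl, fun _ => Or.inl rfl⟩
    | @tail u v _ hbond ih =>
      intro hv
      obtain ⟨hu, -, huv⟩ := hbond
      obtain ⟨hau, hbu, hnu⟩ := ih hu
      by_cases heq : u = v
      · subst heq; exact ⟨hau, hbu, hnu⟩
      · obtain ⟨ha, hb, hn⟩ := hS4 X u v (fa u) (fb u) (fa v) (fb v) (fn u) (fn v) (fc u) (fc v) hu hv heq huv
          (hf u hu) (hf v hv)
        refine ⟨ha.trans hau, hb.trans hbu, fun hne => ?_⟩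
        have hne' : fa u ≠ fb u := by rwa [hau, hbu]
        rcases hn hne' with h1 | h1 <;> rcases hnu hne with h2 | h2
        · exact Or.inl (h1.trans h2)
        · exact Or.inr (h1.trans h2)
        · exact Or.inr (by rw [h1, h2])
        · exact Or.inl (by rw [h1, h2, neg_neg])
  have hfr : ∀ p ∈ K, fa p = fa 0 ∧ fb p = fb 0 ∧ (fa 0 ≠ fb 0 → fn p = fn 0 ∨ fn p = -fn 0) :=
    fun p hp => hprop p hp.2 hp.1
  -- bounds from the frame of `0`
  obtain ⟨ha1, ha2, hb1, hb2, -, -, -, hsep, -⟩ := hf 0 h0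
  -- the two cases
  have hK : ∃ a h : ℝ, 1 / 2 < a ∧ a < 2 ∧ 1 / 2 < h ∧ h < 2 ∧ 0 < a ∧ a ≤ 1 ∧ 0 < h ∧ h ≤ 9 / 10 ∧
      ∃ s : ℤ → ℤ, IsHaggSeq s ∧ ∃ g : EuclideanSpace ℝ (Fin 3) ≃ᵢ EuclideanSpace ℝ (Fin 3), K = g '' barlowStacking a h s := by
    by_cases hlen : fa 0 = fb 0
    · -- one length: Hales's layer theorem (S12) on `K`
      obtain ⟨s, hs, g, hg⟩ := hS12 K (fa 0) ⟨0, h0K⟩ fun p hp => by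
        obtain ⟨hpa, hpb, -⟩ := hfr p hp
        have h := locframe_restrict hKX hcl hp (hf p (hKX hp))
        rw [hpa, hpb, ← hlen] at h
        exact ⟨fn p, fc p, h⟩
      obtain ⟨hh1, hh2⟩ := sqrt_gap_bounds ha1 ha2 (hlen ▸ hb1 : 19 / 20 ≤ fa 0) ha2
      exact ⟨fa 0, Real.sqrt (fa 0 ^ 2 - fa 0 ^ 2 / 3), by linarith, by linarith, hh1, hh2, by linarith, ha2,
        by linarith, sqrt_gap_le ha1 ha2 ha1, s, hs, g, hg⟩
    · -- two lengths: common frame (S3) on `K`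
      obtain ⟨s, hs, g, hg⟩ := hS3 K (fa 0) (fb 0) (fn 0) ⟨0, h0K⟩ fun p hp => by
        obtain ⟨hpa, hpb, hpn⟩ := hfr p hp
        have h := locframe_restrict hKX hcl hp (hf p (hKX hp))
        rw [hpa, hpb] at h
        rcases hpn hlen with hn | hn
        · rw [hn] at h; exact Or.inl ⟨fc p, h⟩
        · rw [hn] at h; exact Or.inr ⟨fc p, h⟩
      obtain ⟨hh1, hh2⟩ := sqrt_gap_bounds ha1 ha2 hb1 hb2
      exact ⟨fa 0, Real.sqrt (fb 0 ^ 2 - fa 0 ^ 2 / 3), by linarith, by linarith, hh1, hh2, by linarith, ha2,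
        by linarith, sqrt_gap_le ha1 hb2 hb1, s, hs, g, hg⟩
  obtain ⟨a, h, ha1', ha2', hh1', hh2', ha0, ha1'', hh0, hh9, s, hs, g, hg⟩ := hK
  have hXK : X = K := eq_of_barlow_subset X K hKX hsep a h ha0 ha1'' hh0 hh9 s g hg
  exact ⟨a, h, ha1', ha2', hh1', hh2', s, hs, g, hXK.trans hg⟩

end Summit.AtomisticToContinuum.Crystallization.Theorems.SquareWellLayerCake.StackingFaultSparsity.LocalFrames.Structure

end
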